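import Summits.ValiantsHypothesis.ValiantsHypothesis.Theorems.SymPencilPerFourRowNoLinearFactor

/-!
# Route `SymPencil` — exact flows of `per [v; ·]` on a hyperplane: the BLOCK-DIAGONAL step
# (tool file for the one-row defect-2 cell `(12,4,2)` of `sdc(per_4)`, `--supports`
# stmt-ValiantsHypothesis-5674; nothing here bears on `VP ≠ VNP`)

For a BLOCK-DIAGONAL linear map `y ↦ (Y₀ y₀, Y₁ y₁, Y₂ y₂)` of `3 × 4` matrices the first-order quantity
`G(y) = DF_v(y)[Y y] = per [v; Y₀y₀; y₁; y₂] + per [v; y₀; Y₁y₁; y₂] + per [v; y₀; y₁; Y₂y₂]` is TRILINEAR in the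
rows.  **`firstOrder_eq_zero_of_blockDiag`**: if `G` vanishes on a hyperplane `ker ℓ` whose linear form sees two
rows (`ℓ(e₁ ⊗ t₁) = ℓ(e₂ ⊗ t₂) = 1`), then `G ≡ 0` (compensating in row `1` and in row `2` writes `G = ℓ·Φ = ℓ·Ψ`
with `Φ` free of row `1` and `Ψ` free of row `2`; a quadratic-in-`s` comparison along `e₂ ⊗ t₂` gives `Φ = Ψ`, and
`Φ = Ψ(row 1 := 0) = 0`).  This is step (b) «≥ 2 rows» of val-width-5674-w2 g2's S1b (CELL-TWELVE-FOUR.md §2):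
after it the tree's `rowScaling_of_deriv_vanish` applies on the whole space.

Elementary; no definitions, no named facts. [folklore]
-/

noncomputable section

-- single-conjunct layout: Sub = Summit, duplicated namespace component intended
set_option linter.dupNamespace false

namespace Summit.ValiantsHypothesis.ValiantsHypothesis.Theorems.SymPencilPerFourHyperplaneFlowBlocks

open Matrix
open Summit.ValiantsHypothesis.ValiantsHypothesis.Theorems.SymPencilPerFourInnerRankRows
open Summit.ValiantsHypothesis.ValiantsHypothesis.Theorems.SymPencilPerFourRowForms
open Summit.ValiantsHypothesis.ValiantsHypothesis.Theorems.SymPencilPerFourRowNoLinearFactor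

variable {K : Type*} [Field K]

/-- **Block-diagonal maps: first order on a two-row hyperplane forces first order everywhere.**
See the module docstring. [folklore] -/
theorem firstOrder_eq_zero_of_blockDiag [CharZero K] (v : Fin 4 → K)
    (Y : Fin 3 → (Fin 4 → K) →ₗ[K] (Fin 4 → K)) (ℓ : (Fin 3 → Fin 4 → K) →ₗ[K] K)
    (t₁ t₂ : Fin 4 → K) (ht₁ : ℓ (Pi.single 1 t₁) = 1) (ht₂ : ℓ (Pi.single 2 t₂) = 1)
    (hD : ∀ y : Fin 3 → Fin 4 → K, ℓ y = 0 →
      (Matrix.of ![v, Y 0 (y 0), y 1, y 2]).permanent + (Matrix.of ![v, y 0, Y 1 (y 1), y 2]).permanent +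
        (Matrix.of ![v, y 0, y 1, Y 2 (y 2)]).permanent = 0) :
    ∀ y : Fin 3 → Fin 4 → K,
      (Matrix.of ![v, Y 0 (y 0), y 1, y 2]).permanent + (Matrix.of ![v, y 0, Y 1 (y 1), y 2]).permanent +
        (Matrix.of ![v, y 0, y 1, Y 2 (y 2)]).permanent = 0 := by
  classical
  -- `Φ` (row 1 replaced by `t₁`) and `Ψ` (row 2 replaced by `t₂`)
  let G : (Fin 3 → Fin 4 → K) → K := fun y =>
    (Matrix.of ![v, Y 0 (y 0), y 1, y 2]).permanent + (Matrix.of ![v, y 0, Y 1 (y 1), y 2]).permanent +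
      (Matrix.of ![v, y 0, y 1, Y 2 (y 2)]).permanent
  let Φ : (Fin 3 → Fin 4 → K) → K := fun y =>
    (Matrix.of ![v, Y 0 (y 0), t₁, y 2]).permanent + (Matrix.of ![v, y 0, Y 1 t₁, y 2]).permanent +
      (Matrix.of ![v, y 0, t₁, Y 2 (y 2)]).permanent
  let Ψ : (Fin 3 → Fin 4 → K) → K := fun y =>
    (Matrix.of ![v, Y 0 (y 0), y 1, t₂]).permanent + (Matrix.of ![v, y 0, Y 1 (y 1), t₂]).permanent +
      (Matrix.of ![v, y 0, y 1, Y 2 t₂]).permanent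
  -- compensation in row 1: `G y = ℓ y * Φ y`
  have hΦ : ∀ y, G y = ℓ y * Φ y := by
    intro y
    set y' : Fin 3 → Fin 4 → K := y + Pi.single 1 ((-ℓ y) • t₁) with hy'
    have hℓ : ℓ y' = 0 := by
      rw [hy', map_add, Pi.single_smul, map_smul, ht₁, smul_eq_mul, mul_one, add_neg_cancel]
    have h0 : y' 0 = y 0 := by simp [hy']
    have h1 : y' 1 = y 1 + (-ℓ y) • t₁ := by simp [hy']
    have h2 : y' 2 = y 2 := by simp [hy']
    have h := hD y' hℓ
    rw [h0, h1, h2, map_add, map_smul, per_add_row₂, per_smul_row₂, per_add_row₂, per_smul_row₂, per_add_row₂,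
      per_smul_row₂] at h
    simp only [G, Φ]
    linear_combination h
  -- compensation in row 2: `G y = ℓ y * Ψ y`
  have hΨ : ∀ y, G y = ℓ y * Ψ y := by
    intro y
    set y' : Fin 3 → Fin 4 → K := y + Pi.single 2 ((-ℓ y) • t₂) with hy'
    have hℓ : ℓ y' = 0 := by
      rw [hy', map_add, Pi.single_smul, map_smul, ht₂, smul_eq_mul, mul_one, add_neg_cancel]
    have h0 : y' 0 = y 0 := by simp [hy']
    have h1 : y' 1 = y 1 := by simp [hy']
    have h2 : y' 2 = y 2 + (-ℓ y) • t₂ := by simp [hy']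
    have h := hD y' hℓ
    rw [h0, h1, h2, map_add, map_smul, per_add_row₃, per_smul_row₃, per_add_row₃, per_smul_row₃, per_add_row₃,
      per_smul_row₃] at h
    simp only [G, Ψ]
    linear_combination h
  -- comparison along `e₂ ⊗ t₂`: `Φ = Ψ`
  have hΦΨ : ∀ y, Φ y = Ψ y := by
    intro y
    -- the quadratic in `s`
    let Φ₁ : K := (Matrix.of ![v, Y 0 (y 0), t₁, t₂]).permanent + (Matrix.of ![v, y 0, Y 1 t₁, t₂]).permanent +
      (Matrix.of ![v, y 0, t₁, Y 2 t₂]).permanent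
    have key : ∀ s : K, ℓ y * (Φ y - Ψ y) + (Φ y - Ψ y + ℓ y * Φ₁) * s + Φ₁ * s ^ 2 + 0 * s ^ 3 = 0 := by
      intro s
      set ys : Fin 3 → Fin 4 → K := y + Pi.single 2 (s • t₂) with hys
      have e1 := hΦ ys
      have e2 := hΨ ys
      have hℓs : ℓ ys = ℓ y + s := by
        rw [hys, map_add, Pi.single_smul, map_smul, ht₂, smul_eq_mul, mul_one]
      have h0 : ys 0 = y 0 := by simp [hys]
      have h1 : ys 1 = y 1 := by simp [hys]
      have h2 : ys 2 = y 2 + s • t₂ := by simp [hys]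
      simp only [G, Φ, Ψ, h0, h1, h2, hℓs, map_add, map_smul, per_add_row₃, per_smul_row₃] at e1 e2
      simp only [Φ₁, Φ, Ψ]
      linear_combination e2 - e1
    obtain ⟨c0, c1, c2, -⟩ := cubic_coeffs_eq_zero _ _ _ _ key
    -- `c2 : Φ₁ = 0`, `c1 : Φ y - Ψ y + ℓ y * Φ₁ = 0`
    have : Φ y - Ψ y = 0 := by linear_combination c1 - ℓ y * c2
    linear_combination this
  -- `Φ` does not see row 1, `Ψ` vanishes when row 1 does
  have hΦ0 : ∀ y, Φ y = 0 := by
    intro y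
    set y' : Fin 3 → Fin 4 → K := Function.update y 1 0 with hy'
    have h0 : y' 0 = y 0 := by simp [hy']
    have h1 : y' 1 = 0 := by simp [hy']
    have h2 : y' 2 = y 2 := by simp [hy']
    have e := hΦΨ y'
    simp only [Φ, Ψ, h0, h1, h2, map_zero, per_zero_row₂] at e
    simp only [Φ]
    linear_combination e
  intro y
  have := hΦ y
  simp only [G] at this
  rw [this, hΦ0 y, mul_zero]

end Summit.ValiantsHypothesis.ValiantsHypothesis.Theorems.SymPencilPerFourHyperplaneFlowBlocks

end
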